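import Summits.BirchSwinnertonDyer.BirchSwinnertonDyer.Theorems.ManinLocalTwoThreeRatioBridge
import HarnessLib

/-!
# The ratio bridge, §4: `η`-combinations — holomorphy and weight-`k` automorphy discharged once and for all

Cell bsd-f2-manin, route `ManinLocalTwoThree` (crux C2 `ManinOddAtFour` stmt-BirchSwinnertonDyer-22967; `--supports` helper),
an g52's TURNKEY T-an-g52-RB v2 (`d614ab751a55eee9`) §4, landed by LEAD p1 g24 as a sequel file to the accepted v1
(`…Theorems.ManinLocalTwoThreeRatioBridge`, p783917; §§1–3 there are byte-identical with v2): `etaCombination`,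
`mdifferentiable_etaCombination`, `etaCombination_smul`, `abs_maninConstant_eq_one_of_etaBracketIdentity` — `A, B` finite
combinations of `η`-quotients of one even weight with Newman's conditions: holomorphy and automorphy discharged, a level file
supplies exponent vectors, coefficients, `NewmanCond` checks, the bracket identity and one non-degenerate point.

HONEST FRAMING: fact-free, standard axioms; nothing here proves C2/C3 for all `N`, Manin's conjecture or BSD.
[cite: Koehler2011, §2.1 and Thm 2.2] [cite: AgasheRibetStein2006, §§1–2] [cite: CremonaAlgorithms1997, §2.10]
-/

set_option autoImplicit false
-- lint-debt: the directory name repeats the summit name (sibling precedent `ManinLocalTwoThreeRatioBridge.lean`)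
set_option linter.dupNamespace false

noncomputable section

open Complex Filter Topology Set Function
open UpperHalfPlane hiding I
open scoped Real Topology Manifold MatrixGroups ModularForm PeriodPair
open CongruenceSubgroup
open Literature.NumberTheory.EllipticCurves Literature.NumberTheory.EllipticCurves.ModularForms

namespace Summit.BirchSwinnertonDyer.BirchSwinnertonDyer.Theorems.ManinLocalTwoThree.RatioBridge

open AnalyticBridge

variable {N : ℕ} [NeZero N]


/-! ## §4 `η`-combinations: holomorphy and weight-`k` automorphy discharged once and for all

The certificates of the data table are pairs `A = ∑ aᵢ·η^{rᵢ}`, `B = ∑ bᵢ·η^{rᵢ}` of FINITE `ℂ`-COMBINATIONS of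
`η`-quotients of level `N` and one even weight `k` (`NewmanCond N rᵢ k`).  For such `A, B` the hypotheses
`hA, hB, hAk, hBk` of §2b/§3 are the two lemmas below, so a level file only has to supply the exponent
vectors, the coefficients, the `NewmanCond` checks (`decide`), the bracket identity and one non-degenerate point. -/

/-- The finite `ℂ`-combination `τ ↦ ∑ i ∈ s, a i · etaQuotient N (r i) τ` of `η`-quotients of level `N`.
[cite: Koehler2011, §2.1] -/
def etaCombination (N : ℕ) {ι : Type*} (s : Finset ι) (a : ι → ℂ) (r : ι → ℕ → ℤ) : ℍ → ℂ :=
  fun τ ↦ ∑ i ∈ s, a i * etaQuotient N (r i) τ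

/-- An `η`-combination is holomorphic on `ℍ`. [cite: Koehler2011, §2.1] -/
theorem mdifferentiable_etaCombination (N : ℕ) {ι : Type*} (s : Finset ι) (a : ι → ℂ) (r : ι → ℕ → ℤ) :
    MDifferentiable 𝓘(ℂ) 𝓘(ℂ) (etaCombination N s a r) := by
  classical
  induction s using Finset.induction_on with
  | empty =>
    have : etaCombination N (∅ : Finset ι) a r = fun _ ↦ (0 : ℂ) := by
      funext τ; simp [etaCombination]
    rw [this]; exact mdifferentiable_const
  | insert i s hi ih =>
    have : etaCombination N (insert i s) a r =
        fun τ ↦ a i * etaQuotient N (r i) τ + etaCombination N s a r τ := by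
      funext τ; simp [etaCombination, Finset.sum_insert hi]
    rw [this]
    exact (mdifferentiable_const.mul (mdifferentiable_etaQuotient N (r i))).add ih

/-- An `η`-combination of one even weight `k` with Newman's conditions termwise transforms under `Γ₀(N)` with
the factor `(cτ + d)^k`. [cite: Koehler2011, Thm 2.2 (Newman)] -/
theorem etaCombination_smul (N : ℕ) (hN : 0 < N) {ι : Type*} (s : Finset ι) (a : ι → ℂ) (r : ι → ℕ → ℤ)
    (k : ℤ) (hk : Even k) (hc : ∀ i ∈ s, NewmanCond N (r i) k) (γ : Gamma0 N) (τ : ℍ) :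
    etaCombination N s a r ((γ : SL(2, ℤ)) • τ) =
      (((γ : SL(2, ℤ)) 1 0 : ℂ) * τ + ((γ : SL(2, ℤ)) 1 1 : ℂ)) ^ k * etaCombination N s a r τ := by
  simp only [etaCombination, Finset.mul_sum]
  refine Finset.sum_congr rfl fun i hi ↦ ?_
  rw [etaQuotient_smul_of_mem_Gamma0 N hN (r i) k hk (hc i hi) γ.2 τ]
  ring

/-- **`|c(D)| = 1` from an `η`-bracket identity.**  The form of §3 a level file uses: `A, B` are
`η`-combinations over ONE finite index set with common exponent family `r` (pad with zero coefficients), all of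
even weight `k` with Newman's conditions; the bracket identity for `(D.f, g₂(L₀), g₃(L₀))` and one
non-degenerate point give `|c(D)| = 1`. [cite: AgasheRibetStein2006, §§1–2] [cite: CremonaAlgorithms1997, §2.10] -/
theorem abs_maninConstant_eq_one_of_etaBracketIdentity
    (W₀ : WeierstrassCurve ℚ) [W₀.IsElliptic] [W₀.IsGloballyMinimal] (L₀ : PeriodPair)
    (hL₀ : IsNeronLatticeOf (W₀.baseChange ℂ) L₀)
    (W : WeierstrassCurve ℚ) [W.IsElliptic] [W.IsGloballyMinimal] (D : ModularParametrizationData W N)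
    (hopt : ∀ z ∈ D.L.lattice, ∃ w ∈ periodLattice D.f, z = D.c * w)
    (hN : 0 < N) (k : ℤ) (hk : Even k) {ι : Type*} (s : Finset ι) (a b : ι → ℂ) (r : ι → ℕ → ℤ)
    (hc : ∀ i ∈ s, NewmanCond N (r i) k)
    (hode : ∀ τ : ℍ,
      (deriv (etaCombination N s a r ∘ ofComplex) τ * etaCombination N s b r τ
        - etaCombination N s a r τ * deriv (etaCombination N s b r ∘ ofComplex) τ) ^ 2 =
      (2 * π * Complex.I * D.f τ) ^ 2 *
        (4 * etaCombination N s a r τ ^ 3 - L₀.g₂ * etaCombination N s a r τ * etaCombination N s b r τ ^ 2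
          - L₀.g₃ * etaCombination N s b r τ ^ 3) * etaCombination N s b r τ)
    (hnd : ∃ τ₀ : ℍ, etaCombination N s b r τ₀ ≠ 0 ∧
      4 * etaCombination N s a r τ₀ ^ 3 - L₀.g₂ * etaCombination N s a r τ₀ * etaCombination N s b r τ₀ ^ 2
        - L₀.g₃ * etaCombination N s b r τ₀ ^ 3 ≠ 0) :
    |D.maninConstant| = 1 :=
  abs_maninConstant_eq_one_of_bracketIdentity W₀ L₀ hL₀ W D hopt (etaCombination N s a r) (etaCombination N s b r)
    (mdifferentiable_etaCombination N s a r) (mdifferentiable_etaCombination N s b r) k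
    (etaCombination_smul N hN s a r k hk hc) (etaCombination_smul N hN s b r k hk hc) hode hnd

end Summit.BirchSwinnertonDyer.BirchSwinnertonDyer.Theorems.ManinLocalTwoThree.RatioBridge

end
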